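import Mathlib

/-!
# Majorana (Clifford) families of matrices: field operators, plane rotations, Wick's operator identity

Topic `MathematicalPhysics/FreeFermions`, namespace `Literature.MathematicalPhysics.FreeFermions`.
The finite-dimensional operator algebra behind the fermionic solution of the planar Ising model
(B. Kaufman, Phys. Rev. 76 (1949) 1232, §§2–3: "spinor analysis"; T. D. Schultz, D. C. Mattis,
E. H. Lieb, Rev. Mod. Phys. 36 (1964) 856, §III; C. J. Thompson, *Mathematical Statistical
Mechanics* (Princeton 1972), Appendix D, eqs. (35)–(49)) and behind Wick's theorem for quasi-free
fermion states (E. Lieb, T. Schultz, D. Mattis, Ann. Phys. 16 (1961) 407, §II and Appendix), set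
up ABSTRACTLY for a family `Γ : ι → Matrix n n ℂ` of pairwise anticommuting Hermitian involutions
("Majorana" or Clifford generators, `IsMajoranaFamily`):

* the **field operators** `fieldOp Γ w = ∑_a w_a Γ_a` (`w : ι → ℂ`), linear in `w`, with the
  Clifford relation `Γ(w)Γ(w') + Γ(w')Γ(w) = 2 (w ⬝ᵥ w') 1` (`fieldOp_mul_fieldOp_add`) and
  `Γ(w)ᴴ = Γ(w̄)`;
* ordered products `prodGen Γ a = Γ_{a 0} Γ_{a 1} ⋯ Γ_{a (m-1)}` of generators and the sign rule for
  moving an anticommuting operator through them (`mul_prodGen_of_anticomm`);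
* **Wick's operator identity** (`fieldOp_mul_prodGen`): for every coefficient vector `x` and
  generators `a : Fin (m+1) → ι`,
  `Γ(x) Γ_{a₀}⋯Γ_{a_m} = ∑_j (-1)^j 2 x_{a_j} Γ_{a₀}⋯Γ̂_{a_j}⋯Γ_{a_m} + (-1)^{m+1} Γ_{a₀}⋯Γ_{a_m} Γ(x)`
  — the algebraic core of Wick's theorem (LSM 1961, Appendix; it becomes the Pfaffian/determinant
  recursion once `Γ(x)` annihilates the state on the right, see `QuasiFreeVacuum.lean`);
* **Kaufman's plane rotations** (Kaufman 1949, §2; Thompson App. D, eqs. (9), (44)): for `a ≠ b` the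
  pair operator `K = i Γ_a Γ_b` squares to one, `P(θ) = cosh θ 1 + sinh θ K` (`planeExp`) satisfies
  `P(θ)P(θ') = P(θ+θ')`, is Hermitian, commutes with every other generator, and conjugates the pair
  `(Γ_a, Γ_b)` by the complex ("hyperbolic") rotation of angle `2iθ`:
  `P(θ) Γ(w) = Γ(R_{ab}(θ) w) P(θ)` with `(R w)_a = cosh 2θ w_a + i sinh 2θ w_b`,
  `(R w)_b = -i sinh 2θ w_a + cosh 2θ w_b` (`implements_planeExp`); the relation
  `T Γ(w) = Γ(f w) T` (`Implements Γ T f`, "`T` implements the map `f` on the generators") is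
  multiplicative (`Implements.mul`), which is how a product of exponentials of fermion bilinears (a
  transfer matrix) induces a product of plane rotations on the `2N` generators (Kaufman's reduction
  from `2^N` to `2N` dimensions).

Everything here is proved; there are no named facts. Deliberately NOT here: states and expectations
(`QuasiFreeVacuum.lean`), any specific model.

## Mathlib / tree status

The linear-combination part of `fieldOp` is Mathlib's `Fintype.linearCombination ℂ Γ`
(`fieldOp_eq_linearCombination`); what is new here is the Clifford relation for such combinations,
the ordered products / Wick operator identity, and Kaufman's plane rotations with the `Implements`
calculus. Mathlib has `CliffordAlgebra` (the universal algebra of a quadratic form) but no API for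
concrete matrix families of anticommuting involutions or Wick identities (`rg` for `anticommut`,
`Majorana`, `Wick` in Mathlib: nothing relevant). The tree's
`Literature.MathematicalPhysics.QuantumLattice.FermionOperators` (occupation-number Fock space
`Finset ι → ℂ`, `creation`/`annihilation`) is a particular representation; the Ising transfer matrix
lives on its own row space (`Literature.Probability.LatticeModels.IsingMajorana` provides the
Majorana family there), so the present file is kept representation-independent. Anchors used:
`Finset.sum`, `dotProduct`, `Matrix.conjTranspose_smul`, `List.ofFn_succ`, `Fin.succAbove`,
`Real.cosh_add`, `Real.sinh_add`.
-/

noncomputable section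

open Matrix Complex Finset

namespace Literature.MathematicalPhysics.FreeFermions

variable {n ι : Type*}

/-! ### Majorana families -/

/-- A **Majorana (Clifford) family**: matrices `Γ_a`, `a ∈ ι`, with `Γ_a² = 1`,
`Γ_a Γ_b = -Γ_b Γ_a` for `a ≠ b`, and `Γ_aᴴ = Γ_a` — i.e. `Γ_a Γ_b + Γ_b Γ_a = 2δ_{ab}`
(Thompson 1972, App. D, eq. (49); Kaufman 1949, §2; SML 1964, §III). [cite: Thompson2015, Appendix D, eq. (49)] -/
structure IsMajoranaFamily [Fintype n] [DecidableEq n] (Γ : ι → Matrix n n ℂ) : Prop where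
  /-- each generator is an involution -/
  mul_self : ∀ a, Γ a * Γ a = 1
  /-- distinct generators anticommute -/
  anticomm : ∀ ⦃a b : ι⦄, a ≠ b → Γ a * Γ b = -(Γ b * Γ a)
  /-- each generator is Hermitian -/
  conjTranspose_eq : ∀ a, (Γ a)ᴴ = Γ a

/-! ### Field operators `Γ(w) = ∑ w_a Γ_a` -/

section Field

variable [Fintype ι]

/-- The **field operator** `Γ(w) = ∑_a w_a Γ_a` with complex coefficients `w : ι → ℂ`
(SML 1964, §III: linear combinations of the fermion operators). [cite: SchultzMattisLieb1964, §III] -/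
def fieldOp (Γ : ι → Matrix n n ℂ) (w : ι → ℂ) : Matrix n n ℂ := ∑ a, w a • Γ a

/-- **Bridge to Mathlib**: as a function of the coefficient vector, the field operator IS Mathlib's
`Fintype.linearCombination ℂ Γ` (a `ℂ`-linear map `(ι → ℂ) →ₗ[ℂ] Matrix n n ℂ`); `fieldOp` is kept as
the domain name for its values, and its linearity lemmas below are the specialisations of `map_add`
etc. [folklore] -/
theorem fieldOp_eq_linearCombination (Γ : ι → Matrix n n ℂ) (w : ι → ℂ) :
    fieldOp Γ w = Fintype.linearCombination ℂ Γ w := by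
  rw [Fintype.linearCombination_apply]
  rfl

/-- `Γ(e_a) = Γ_a`. [folklore] -/
theorem fieldOp_single [DecidableEq ι] (Γ : ι → Matrix n n ℂ) (a : ι) :
    fieldOp Γ (Pi.single a 1) = Γ a := by
  unfold fieldOp
  rw [Finset.sum_eq_single a]
  · simp
  · intro b _ hb; simp [hb]
  · intro h; exact absurd (mem_univ a) h

/-- `Γ(w + w') = Γ(w) + Γ(w')`. [folklore] -/
theorem fieldOp_add (Γ : ι → Matrix n n ℂ) (w w' : ι → ℂ) :
    fieldOp Γ (w + w') = fieldOp Γ w + fieldOp Γ w' := by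
  simp [fieldOp, add_smul, sum_add_distrib]

/-- `Γ(c w) = c Γ(w)`. [folklore] -/
theorem fieldOp_smul (Γ : ι → Matrix n n ℂ) (c : ℂ) (w : ι → ℂ) :
    fieldOp Γ (c • w) = c • fieldOp Γ w := by
  simp [fieldOp, smul_sum, smul_smul]

/-- `Γ(0) = 0`. [folklore] -/
theorem fieldOp_zero (Γ : ι → Matrix n n ℂ) : fieldOp Γ 0 = 0 := by
  simp [fieldOp]

/-- `Γ(-w) = -Γ(w)`. [folklore] -/
theorem fieldOp_neg (Γ : ι → Matrix n n ℂ) (w : ι → ℂ) : fieldOp Γ (-w) = -fieldOp Γ w := by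
  simp [fieldOp, sum_neg_distrib]

/-- `Γ(w - w') = Γ(w) - Γ(w')`. [folklore] -/
theorem fieldOp_sub (Γ : ι → Matrix n n ℂ) (w w' : ι → ℂ) :
    fieldOp Γ (w - w') = fieldOp Γ w - fieldOp Γ w' := by
  rw [sub_eq_add_neg, fieldOp_add, fieldOp_neg, sub_eq_add_neg]

/-- `Γ(∑_k f_k) = ∑_k Γ(f_k)`. [folklore] -/
theorem fieldOp_sum (Γ : ι → Matrix n n ℂ) {κ : Type*} (s : Finset κ) (f : κ → ι → ℂ) :
    fieldOp Γ (∑ k ∈ s, f k) = ∑ k ∈ s, fieldOp Γ (f k) := by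
  classical
  induction s using Finset.induction_on with
  | empty => simp [fieldOp_zero]
  | insert k s hk ih => rw [sum_insert hk, sum_insert hk, fieldOp_add, ih]

/-- `Γ(w)ᴴ = Γ(w̄)` when every generator is Hermitian. [folklore] -/
theorem conjTranspose_fieldOp {Γ : ι → Matrix n n ℂ} (hΓ : ∀ a, (Γ a)ᴴ = Γ a) (w : ι → ℂ) :
    (fieldOp Γ w)ᴴ = fieldOp Γ (star w) := by
  simp only [fieldOp, conjTranspose_sum, conjTranspose_smul, hΓ]
  rfl

end Field

section Clifford

variable [Fintype n] [DecidableEq n] [Fintype ι] {Γ : ι → Matrix n n ℂ}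

/-- **The anticommutator of a field with a generator**: `Γ(w) Γ_b + Γ_b Γ(w) = 2 w_b · 1`. [cite: Thompson2015, Appendix D, eq. (49)] -/
theorem fieldOp_mul_gen_add (hΓ : IsMajoranaFamily Γ) (w : ι → ℂ) (b : ι) :
    fieldOp Γ w * Γ b + Γ b * fieldOp Γ w = (2 * w b) • (1 : Matrix n n ℂ) := by
  classical
  unfold fieldOp
  rw [sum_mul, mul_sum, ← sum_add_distrib]
  have key : ∀ a, (w a • Γ a) * Γ b + Γ b * (w a • Γ a) =
      if a = b then (2 * w b) • (1 : Matrix n n ℂ) else 0 := by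
    intro a
    rw [smul_mul_assoc, mul_smul_comm, ← smul_add]
    by_cases hab : a = b
    · subst hab
      rw [if_pos rfl, hΓ.mul_self, ← two_smul ℂ (1 : Matrix n n ℂ), smul_smul, mul_comm]
    · rw [if_neg hab, hΓ.anticomm hab, neg_add_cancel, smul_zero]
  simp_rw [key]
  rw [Finset.sum_ite_eq' univ b, if_pos (mem_univ b)]

/-- `Γ(w) Γ_b = 2 w_b · 1 - Γ_b Γ(w)`. [folklore] -/
theorem fieldOp_mul_gen (hΓ : IsMajoranaFamily Γ) (w : ι → ℂ) (b : ι) :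
    fieldOp Γ w * Γ b = (2 * w b) • (1 : Matrix n n ℂ) - Γ b * fieldOp Γ w := by
  rw [← fieldOp_mul_gen_add hΓ w b, add_sub_cancel_right]

/-- **The Clifford relation for fields**: `Γ(w) Γ(w') + Γ(w') Γ(w) = 2 (w ⬝ᵥ w') · 1`, with the
BILINEAR (not sesquilinear) pairing `w ⬝ᵥ w' = ∑_a w_a w'_a`. [cite: Thompson2015, Appendix D, eq. (49)] -/
theorem fieldOp_mul_fieldOp_add (hΓ : IsMajoranaFamily Γ) (w w' : ι → ℂ) :
    fieldOp Γ w * fieldOp Γ w' + fieldOp Γ w' * fieldOp Γ w = (2 * (w ⬝ᵥ w')) • (1 : Matrix n n ℂ) := by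
  have h1 : fieldOp Γ w * fieldOp Γ w' = ∑ b, w' b • (fieldOp Γ w * Γ b) := by
    unfold fieldOp
    rw [mul_sum]
    refine sum_congr rfl fun b _ => ?_
    rw [mul_smul_comm]
  have h2 : fieldOp Γ w' * fieldOp Γ w = ∑ b, w' b • (Γ b * fieldOp Γ w) := by
    conv_lhs => rw [fieldOp]
    rw [sum_mul]
    refine sum_congr rfl fun b _ => ?_
    rw [smul_mul_assoc]
  rw [h1, h2, ← sum_add_distrib, dotProduct, mul_sum, sum_smul]
  refine sum_congr rfl fun b _ => ?_
  rw [← smul_add, fieldOp_mul_gen_add hΓ, smul_smul]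
  congr 1
  ring

/-- The two orders of a field product differ by the scalar `2 (w ⬝ᵥ w')`:
`Γ(w) Γ(w') = 2 (w ⬝ᵥ w') 1 - Γ(w') Γ(w)`. [folklore] -/
theorem fieldOp_mul_fieldOp (hΓ : IsMajoranaFamily Γ) (w w' : ι → ℂ) :
    fieldOp Γ w * fieldOp Γ w' = (2 * (w ⬝ᵥ w')) • (1 : Matrix n n ℂ) - fieldOp Γ w' * fieldOp Γ w := by
  rw [← fieldOp_mul_fieldOp_add hΓ w w', add_sub_cancel_right]

end Clifford

/-! ### Ordered products of generators -/

section Products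

variable [Fintype n] [DecidableEq n]

/-- The ordered product `Γ_{a 0} Γ_{a 1} ⋯ Γ_{a (m-1)}` of generators. [folklore] -/
def prodGen (Γ : ι → Matrix n n ℂ) {m : ℕ} (a : Fin m → ι) : Matrix n n ℂ :=
  (List.ofFn fun i => Γ (a i)).prod

/-- The empty product is `1`. [folklore] -/
@[simp] theorem prodGen_zero (Γ : ι → Matrix n n ℂ) (a : Fin 0 → ι) : prodGen Γ a = 1 := by
  simp [prodGen]

/-- `Γ_{a₀} ⋯ Γ_{a_m} = Γ_{a₀} (Γ_{a₁} ⋯ Γ_{a_m})`. [folklore] -/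
theorem prodGen_succ (Γ : ι → Matrix n n ℂ) {m : ℕ} (a : Fin (m + 1) → ι) :
    prodGen Γ a = Γ (a 0) * prodGen Γ (fun i => a i.succ) := by
  rw [prodGen, List.ofFn_succ, List.prod_cons]
  rfl

/-- `Γ_{a₀} ⋯ Γ_{a_m} = (Γ_{a₀} ⋯ Γ_{a_{m-1}}) Γ_{a_m}`. [folklore] -/
theorem prodGen_succ' (Γ : ι → Matrix n n ℂ) {m : ℕ} (a : Fin (m + 1) → ι) :
    prodGen Γ a = prodGen Γ (fun i => a i.castSucc) * Γ (a (Fin.last m)) := by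
  rw [prodGen, List.ofFn_succ', List.prod_concat]
  rfl

/-- A one-term product. [folklore] -/
theorem prodGen_one (Γ : ι → Matrix n n ℂ) (a : Fin 1 → ι) : prodGen Γ a = Γ (a 0) := by
  rw [prodGen_succ, prodGen_zero, mul_one]

/-- **Sign rule**: an operator anticommuting with each factor passes through an ordered product of
`m` generators with the sign `(-1)^m`. [folklore] -/
theorem mul_prodGen_of_anticomm {Γ : ι → Matrix n n ℂ} {X : Matrix n n ℂ} {m : ℕ} {a : Fin m → ι}
    (h : ∀ i, X * Γ (a i) = -(Γ (a i) * X)) :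
    X * prodGen Γ a = (-1 : ℂ) ^ m • (prodGen Γ a * X) := by
  induction m with
  | zero => simp
  | succ m ih =>
    rw [prodGen_succ, ← mul_assoc, h 0, neg_mul, mul_assoc, ih (fun i => h i.succ), mul_smul_comm,
      ← mul_assoc, pow_succ, mul_neg_one, neg_smul]

/-- A generator distinct from all factors passes through an ordered product of `m` generators with
the sign `(-1)^m`. [folklore] -/
theorem gen_mul_prodGen_of_ne {Γ : ι → Matrix n n ℂ} (hΓ : IsMajoranaFamily Γ) {c : ι} {m : ℕ}
    {a : Fin m → ι} (h : ∀ i, a i ≠ c) :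
    Γ c * prodGen Γ a = (-1 : ℂ) ^ m • (prodGen Γ a * Γ c) :=
  mul_prodGen_of_anticomm fun i => hΓ.anticomm (h i).symm

variable [Fintype ι]

/-- **Wick's operator identity** (the algebraic recursion behind Wick's theorem; LSM 1961,
Appendix; SML 1964, §IV): for a coefficient vector `x` and generators `a₀, …, a_m`,
`Γ(x) Γ_{a₀}⋯Γ_{a_m} = ∑_j (-1)^j (2 x_{a_j}) Γ_{a₀}⋯Γ̂_{a_j}⋯Γ_{a_m} + (-1)^{m+1} Γ_{a₀}⋯Γ_{a_m} Γ(x)`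
(the omitted factor is realised by `Fin.succAbove`). [cite: LiebSchultzMattisAP1961, Appendix (Wick's theorem recursion)] -/
theorem fieldOp_mul_prodGen {Γ : ι → Matrix n n ℂ} (hΓ : IsMajoranaFamily Γ) (x : ι → ℂ) {m : ℕ}
    (a : Fin (m + 1) → ι) :
    fieldOp Γ x * prodGen Γ a =
      (∑ j : Fin (m + 1), ((-1 : ℂ) ^ (j : ℕ) * (2 * x (a j))) •
          prodGen Γ (fun i => a (j.succAbove i))) +
        (-1 : ℂ) ^ (m + 1) • (prodGen Γ a * fieldOp Γ x) := by
  induction m with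
  | zero =>
    rw [Fin.sum_univ_one, prodGen_one, prodGen_zero, fieldOp_mul_gen hΓ]
    simp [sub_eq_add_neg]
  | succ m ih =>
    rw [prodGen_succ, ← mul_assoc, fieldOp_mul_gen hΓ, sub_mul, smul_mul_assoc, one_mul, mul_assoc,
      ih (fun i => a i.succ), Fin.sum_univ_succ (n := m + 1)]
    simp only [Fin.val_zero, pow_zero, one_mul, Fin.succAbove_zero_apply, Fin.val_succ, mul_add, mul_sum,
      mul_smul_comm]
    have hterm : ∀ k : Fin (m + 1),
        prodGen Γ (fun i => a ((k.succ).succAbove i)) =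
          Γ (a 0) * prodGen Γ (fun i => a (k.succAbove i).succ) := by
      intro k
      rw [prodGen_succ]
      simp only [Fin.succ_succAbove_zero, Fin.succ_succAbove_succ]
    simp_rw [hterm]
    have h1 : ∑ k : Fin (m + 1), ((-1 : ℂ) ^ ((k : ℕ) + 1) * (2 * x (a k.succ))) •
          (Γ (a 0) * prodGen Γ fun i => a (k.succAbove i).succ) =
        -∑ k : Fin (m + 1), ((-1 : ℂ) ^ (k : ℕ) * (2 * x (a k.succ))) •
          (Γ (a 0) * prodGen Γ fun i => a (k.succAbove i).succ) := by
      rw [← sum_neg_distrib]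
      refine sum_congr rfl fun k _ => ?_
      rw [← neg_smul, pow_succ]
      congr 1
      ring
    have h2 : ((-1 : ℂ) ^ (m + 1 + 1)) • (Γ (a 0) * prodGen Γ (fun i => a i.succ) * fieldOp Γ x) =
        -((-1 : ℂ) ^ (m + 1) • (Γ (a 0) * (prodGen Γ (fun i => a i.succ) * fieldOp Γ x))) := by
      rw [pow_succ, mul_neg_one, neg_smul, mul_assoc]
    rw [h1, h2]
    abel

end Products

/-! ### Kaufman's plane rotations -/

section Plane

variable [Fintype n] [DecidableEq n] {Γ : ι → Matrix n n ℂ}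

/-- The pair operator `K_{ab} = i Γ_a Γ_b` (Hermitian, squares to one for `a ≠ b`): the fermion
bilinear whose exponential is a factor of the transfer matrix (Thompson 1972, App. D, eqs. (37)–(40);
Kaufman 1949, §2). [cite: Thompson2015, Appendix D, eqs. (37)–(40)] -/
def pairOp (Γ : ι → Matrix n n ℂ) (a b : ι) : Matrix n n ℂ := (I : ℂ) • (Γ a * Γ b)

/-- `K_{ab}² = 1` for `a ≠ b` (Thompson App. D, eq. (43)). [cite: Thompson2015, Appendix D, eq. (43)] -/
theorem pairOp_mul_self (hΓ : IsMajoranaFamily Γ) {a b : ι} (hab : a ≠ b) :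
    pairOp Γ a b * pairOp Γ a b = 1 := by
  rw [pairOp, smul_mul_smul_comm, I_mul_I, mul_assoc, ← mul_assoc (Γ b) (Γ a), ← neg_neg (Γ b * Γ a),
    ← hΓ.anticomm hab, neg_mul, mul_assoc, hΓ.mul_self, mul_one, mul_neg, hΓ.mul_self, smul_neg,
    neg_smul, neg_neg, one_smul]

/-- `K_{ab}` is Hermitian. [folklore] -/
theorem conjTranspose_pairOp (hΓ : IsMajoranaFamily Γ) {a b : ι} (hab : a ≠ b) :
    (pairOp Γ a b)ᴴ = pairOp Γ a b := by
  rw [pairOp, conjTranspose_smul, conjTranspose_mul, hΓ.conjTranspose_eq, hΓ.conjTranspose_eq,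
    hΓ.anticomm (Ne.symm hab), Complex.star_def, conj_I, smul_neg, neg_smul, neg_neg]

/-- `K_{ab} Γ_a = -i Γ_b`. [folklore] -/
theorem pairOp_mul_left (hΓ : IsMajoranaFamily Γ) {a b : ι} (hab : a ≠ b) :
    pairOp Γ a b * Γ a = -((I : ℂ) • Γ b) := by
  rw [pairOp, smul_mul_assoc, mul_assoc, ← neg_neg (Γ b * Γ a), ← hΓ.anticomm hab, mul_neg,
    ← mul_assoc, hΓ.mul_self, one_mul, smul_neg]

/-- `Γ_a K_{ab} = i Γ_b`. [folklore] -/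
theorem left_mul_pairOp (hΓ : IsMajoranaFamily Γ) (a b : ι) :
    Γ a * pairOp Γ a b = (I : ℂ) • Γ b := by
  rw [pairOp, mul_smul_comm, ← mul_assoc, hΓ.mul_self, one_mul]

/-- `K_{ab} Γ_b = i Γ_a`. [folklore] -/
theorem pairOp_mul_right (hΓ : IsMajoranaFamily Γ) (a b : ι) :
    pairOp Γ a b * Γ b = (I : ℂ) • Γ a := by
  rw [pairOp, smul_mul_assoc, mul_assoc, hΓ.mul_self, mul_one]

/-- `Γ_b K_{ab} = -i Γ_a`. [folklore] -/
theorem right_mul_pairOp (hΓ : IsMajoranaFamily Γ) {a b : ι} (hab : a ≠ b) :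
    Γ b * pairOp Γ a b = -((I : ℂ) • Γ a) := by
  rw [pairOp, mul_smul_comm, ← mul_assoc, ← neg_neg (Γ b * Γ a), ← hΓ.anticomm hab, neg_mul,
    mul_assoc, hΓ.mul_self, mul_one, smul_neg]

/-- `K_{ab}` commutes with every other generator. [folklore] -/
theorem pairOp_mul_of_ne (hΓ : IsMajoranaFamily Γ) {a b c : ι} (hca : c ≠ a) (hcb : c ≠ b) :
    pairOp Γ a b * Γ c = Γ c * pairOp Γ a b := by
  rw [pairOp, smul_mul_assoc, mul_smul_comm, mul_assoc, hΓ.anticomm (Ne.symm hcb), mul_neg, ← mul_assoc,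
    hΓ.anticomm (Ne.symm hca), neg_mul, neg_neg, mul_assoc]

/-- **Kaufman's plane rotation operator** `P_{ab}(θ) = cosh θ · 1 + sinh θ · K_{ab} = exp(θ K_{ab})`
(`K_{ab} = iΓ_aΓ_b`, `K² = 1`; Thompson 1972, App. D, eqs. (9), (44); Kaufman 1949, §2). The factors
`exp(β* σˣ_j)` and `exp((β/2) σᶻ_jσᶻ_{j+1})` of the Ising transfer matrix are of this form. Intended for
`a ≠ b` (at `a = b`, `K = i · 1` and `P(θ)` is the junk scalar `cosh θ + i sinh θ`; every theorem
assumes `a ≠ b`). [cite: Thompson2015, Appendix D, eqs. (9) and (44)] -/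
def planeExp (Γ : ι → Matrix n n ℂ) (a b : ι) (θ : ℝ) : Matrix n n ℂ :=
  ((Real.cosh θ : ℝ) : ℂ) • (1 : Matrix n n ℂ) + ((Real.sinh θ : ℝ) : ℂ) • pairOp Γ a b

/-- **Group law** `P(θ) P(θ') = P(θ + θ')` (addition formulas for `cosh`, `sinh` and `K² = 1`). [cite: Thompson2015, Appendix D, eq. (9)] -/
theorem planeExp_mul_planeExp (hΓ : IsMajoranaFamily Γ) {a b : ι} (hab : a ≠ b) (θ θ' : ℝ) :
    planeExp Γ a b θ * planeExp Γ a b θ' = planeExp Γ a b (θ + θ') := by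
  simp only [planeExp, add_mul, mul_add, smul_mul_assoc, mul_smul_comm, one_mul, mul_one,
    pairOp_mul_self hΓ hab, Real.cosh_add, Real.sinh_add]
  push_cast
  module

/-- `P(0) = 1`. [folklore] -/
@[simp] theorem planeExp_zero (Γ : ι → Matrix n n ℂ) (a b : ι) : planeExp Γ a b 0 = 1 := by
  simp [planeExp]

/-- `P(θ) P(-θ) = 1`. [folklore] -/
theorem planeExp_mul_planeExp_neg (hΓ : IsMajoranaFamily Γ) {a b : ι} (hab : a ≠ b) (θ : ℝ) :
    planeExp Γ a b θ * planeExp Γ a b (-θ) = 1 := by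
  rw [planeExp_mul_planeExp hΓ hab, add_neg_cancel, planeExp_zero]

/-- `P(-θ) P(θ) = 1`. [folklore] -/
theorem planeExp_neg_mul_planeExp (hΓ : IsMajoranaFamily Γ) {a b : ι} (hab : a ≠ b) (θ : ℝ) :
    planeExp Γ a b (-θ) * planeExp Γ a b θ = 1 := by
  rw [planeExp_mul_planeExp hΓ hab, neg_add_cancel, planeExp_zero]

/-- `P(θ)` is Hermitian (real coefficients, `K` Hermitian). [folklore] -/
theorem conjTranspose_planeExp (hΓ : IsMajoranaFamily Γ) {a b : ι} (hab : a ≠ b) (θ : ℝ) :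
    (planeExp Γ a b θ)ᴴ = planeExp Γ a b θ := by
  rw [planeExp, conjTranspose_add, conjTranspose_smul, conjTranspose_smul, conjTranspose_one,
    conjTranspose_pairOp hΓ hab]
  congr 1 <;> congr 1 <;> exact Complex.conj_ofReal _

/-- `P_{ab}(θ)` commutes with every generator off the plane. [cite: Thompson2015, Appendix D, eqs. (31)–(34)] -/
theorem planeExp_mul_of_ne (hΓ : IsMajoranaFamily Γ) {a b c : ι} (hca : c ≠ a) (hcb : c ≠ b) (θ : ℝ) :
    planeExp Γ a b θ * Γ c = Γ c * planeExp Γ a b θ := by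
  simp only [planeExp, add_mul, mul_add, smul_mul_assoc, mul_smul_comm, one_mul, mul_one,
    pairOp_mul_of_ne hΓ hca hcb]

/-- `Γ_a P(-θ) = P(θ) Γ_a`: the first generator of the plane anticommutes with `K_{ab}`. [folklore] -/
theorem left_mul_planeExp_neg (hΓ : IsMajoranaFamily Γ) {a b : ι} (hab : a ≠ b) (θ : ℝ) :
    Γ a * planeExp Γ a b (-θ) = planeExp Γ a b θ * Γ a := by
  simp only [planeExp, add_mul, mul_add, smul_mul_assoc, mul_smul_comm, one_mul, mul_one,
    pairOp_mul_left hΓ hab, left_mul_pairOp hΓ, Real.cosh_neg, Real.sinh_neg, Complex.ofReal_neg, smul_neg,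
    neg_smul, mul_neg]

/-- `Γ_b P(-θ) = P(θ) Γ_b`: the second generator of the plane anticommutes with `K_{ab}`. [folklore] -/
theorem right_mul_planeExp_neg (hΓ : IsMajoranaFamily Γ) {a b : ι} (hab : a ≠ b) (θ : ℝ) :
    Γ b * planeExp Γ a b (-θ) = planeExp Γ a b θ * Γ b := by
  simp only [planeExp, add_mul, mul_add, smul_mul_assoc, mul_smul_comm, one_mul, mul_one,
    pairOp_mul_right hΓ, right_mul_pairOp hΓ hab, Real.cosh_neg, Real.sinh_neg, Complex.ofReal_neg, smul_neg,
    neg_smul, neg_neg, mul_neg]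

/-- **Conjugation of the first generator of the plane**:
`P(θ) Γ_a = (cosh 2θ Γ_a - i sinh 2θ Γ_b) P(θ)` (Kaufman 1949, §2: the spin representative of a
plane rotation by the imaginary angle `2iθ`; `P(θ)Γ_a P(-θ) = P(θ)²Γ_a = P(2θ)Γ_a`). [cite: KaufmanPhysRev1949, §2] -/
theorem planeExp_mul_left (hΓ : IsMajoranaFamily Γ) {a b : ι} (hab : a ≠ b) (θ : ℝ) :
    planeExp Γ a b θ * Γ a =
      (((Real.cosh (2 * θ) : ℝ) : ℂ) • Γ a - (((Real.sinh (2 * θ) : ℝ) : ℂ) * I) • Γ b) *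
        planeExp Γ a b θ := by
  have h : planeExp Γ a b θ * Γ a = (planeExp Γ a b (2 * θ) * Γ a) * planeExp Γ a b θ := by
    conv_lhs => rw [← mul_one (planeExp Γ a b θ * Γ a), ← planeExp_neg_mul_planeExp hΓ hab θ, ← mul_assoc,
      mul_assoc (planeExp Γ a b θ) (Γ a), left_mul_planeExp_neg hΓ hab, ← mul_assoc,
      planeExp_mul_planeExp hΓ hab, ← two_mul]
  rw [h]
  congr 1
  rw [planeExp, add_mul, smul_mul_assoc, smul_mul_assoc, one_mul, pairOp_mul_left hΓ hab, smul_neg,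
    smul_smul, sub_eq_add_neg]

/-- **Conjugation of the second generator of the plane**:
`P(θ) Γ_b = (i sinh 2θ Γ_a + cosh 2θ Γ_b) P(θ)`. [cite: KaufmanPhysRev1949, §2] -/
theorem planeExp_mul_right (hΓ : IsMajoranaFamily Γ) {a b : ι} (hab : a ≠ b) (θ : ℝ) :
    planeExp Γ a b θ * Γ b =
      ((((Real.sinh (2 * θ) : ℝ) : ℂ) * I) • Γ a + ((Real.cosh (2 * θ) : ℝ) : ℂ) • Γ b) *
        planeExp Γ a b θ := by
  have h : planeExp Γ a b θ * Γ b = (planeExp Γ a b (2 * θ) * Γ b) * planeExp Γ a b θ := by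
    conv_lhs => rw [← mul_one (planeExp Γ a b θ * Γ b), ← planeExp_neg_mul_planeExp hΓ hab θ, ← mul_assoc,
      mul_assoc (planeExp Γ a b θ) (Γ b), right_mul_planeExp_neg hΓ hab, ← mul_assoc,
      planeExp_mul_planeExp hΓ hab, ← two_mul]
  rw [h]
  congr 1
  rw [planeExp, add_mul, smul_mul_assoc, smul_mul_assoc, one_mul, pairOp_mul_right hΓ, smul_smul,
    add_comm]

end Plane

/-! ### The induced plane rotation on coefficient vectors -/

section Rot

variable [DecidableEq ι]

/-- The linear map induced on coefficient vectors by conjugation with `P_{ab}(θ)`: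
`(R w)_a = cosh 2θ w_a + i sinh 2θ w_b`, `(R w)_b = -i sinh 2θ w_a + cosh 2θ w_b`, `(R w)_c = w_c`
otherwise — a complex orthogonal ("hyperbolic") rotation of the `(a,b)` plane by the angle `2iθ`
(Kaufman 1949, §2; Thompson App. D, before eq. (50): "spin representations of the `2m`-dimensional
rotation group"). Intended for `a ≠ b` (at `a = b` the first branch wins and the map is the junk
`w_a ↦ (cosh 2θ + i sinh 2θ) w_a`; the theorems assume `a ≠ b`). [cite: KaufmanPhysRev1949, §2] -/
def planeRot (a b : ι) (θ : ℝ) (w : ι → ℂ) : ι → ℂ := fun c =>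
  if c = a then ((Real.cosh (2 * θ) : ℝ) : ℂ) * w a + ((Real.sinh (2 * θ) : ℝ) : ℂ) * I * w b
  else if c = b then -(((Real.sinh (2 * θ) : ℝ) : ℂ) * I) * w a + ((Real.cosh (2 * θ) : ℝ) : ℂ) * w b
  else w c

/-- `(R w)_a`. [folklore] -/
theorem planeRot_apply_left (a b : ι) (θ : ℝ) (w : ι → ℂ) :
    planeRot a b θ w a = ((Real.cosh (2 * θ) : ℝ) : ℂ) * w a + ((Real.sinh (2 * θ) : ℝ) : ℂ) * I * w b := by
  simp [planeRot]

/-- `(R w)_b` for `a ≠ b`. [folklore] -/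
theorem planeRot_apply_right {a b : ι} (hab : a ≠ b) (θ : ℝ) (w : ι → ℂ) :
    planeRot a b θ w b = -(((Real.sinh (2 * θ) : ℝ) : ℂ) * I) * w a + ((Real.cosh (2 * θ) : ℝ) : ℂ) * w b := by
  simp [planeRot, Ne.symm hab]

/-- `(R w)_c = w_c` off the plane. [folklore] -/
theorem planeRot_apply_of_ne {a b c : ι} (hca : c ≠ a) (hcb : c ≠ b) (θ : ℝ) (w : ι → ℂ) :
    planeRot a b θ w c = w c := by
  simp [planeRot, hca, hcb]

/-- `R` is additive. [folklore] -/
theorem planeRot_add (a b : ι) (θ : ℝ) (w w' : ι → ℂ) :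
    planeRot a b θ (w + w') = planeRot a b θ w + planeRot a b θ w' := by
  funext c
  simp only [planeRot, Pi.add_apply]
  split_ifs <;> ring

/-- `R` is homogeneous. [folklore] -/
theorem planeRot_smul (a b : ι) (θ : ℝ) (c : ℂ) (w : ι → ℂ) :
    planeRot a b θ (c • w) = c • planeRot a b θ w := by
  funext d
  simp only [planeRot, Pi.smul_apply, smul_eq_mul]
  split_ifs <;> ring

end Rot

/-! ### Implemented maps -/

section Impl

variable [Fintype n] [Fintype ι]

/-- `T` **implements** the map `f` on coefficient vectors: `T Γ(w) = Γ(f w) T` for all `w` (for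
invertible `T`: `T Γ(w) T⁻¹ = Γ(f w)`; Kaufman 1949, §2, the correspondence between spin
representatives and rotations). No linearity or invertibility is built in. [cite: KaufmanPhysRev1949, §2] -/
def Implements (Γ : ι → Matrix n n ℂ) (T : Matrix n n ℂ) (f : (ι → ℂ) → (ι → ℂ)) : Prop :=
  ∀ w, T * fieldOp Γ w = fieldOp Γ (f w) * T

variable {Γ : ι → Matrix n n ℂ}

/-- **Multiplicativity**: if `T₁` implements `f₁` and `T₂` implements `f₂` then `T₁ T₂` implements
`f₁ ∘ f₂` (Kaufman 1949, §2: products of spin representatives represent products of rotations). [cite: KaufmanPhysRev1949, §2] -/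
theorem Implements.mul {T₁ T₂ : Matrix n n ℂ} {f₁ f₂ : (ι → ℂ) → (ι → ℂ)}
    (h₁ : Implements Γ T₁ f₁) (h₂ : Implements Γ T₂ f₂) : Implements Γ (T₁ * T₂) (f₁ ∘ f₂) := by
  intro w
  rw [mul_assoc, h₂ w, ← mul_assoc, h₁ (f₂ w), mul_assoc]
  rfl

/-- An operator commuting with every generator implements the identity. [folklore] -/
theorem implements_id_of_commute {T : Matrix n n ℂ} (h : ∀ c, T * Γ c = Γ c * T) : Implements Γ T id := by
  intro w
  simp only [fieldOp, mul_sum, sum_mul, mul_smul_comm, smul_mul_assoc, h, id]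

/-- A scalar multiple of an implementer implements the same map. [folklore] -/
theorem Implements.smul {T : Matrix n n ℂ} {f : (ι → ℂ) → (ι → ℂ)} (h : Implements Γ T f) (c : ℂ) :
    Implements Γ (c • T) f := by
  intro w
  rw [smul_mul_assoc, h w, mul_smul_comm]

variable [DecidableEq n]

/-- The identity implements the identity. [folklore] -/
theorem implements_one (Γ : ι → Matrix n n ℂ) : Implements Γ 1 id := fun w => by simp

variable [DecidableEq ι]

/-- (Helper, generic `Finset` bookkeeping.) Splitting a sum over `ι` into the terms at `a`, at
`b ≠ a`, and the rest. [folklore] -/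
theorem sum_eq_add_add_sum_erase_erase {M : Type*} [AddCommMonoid M] {a b : ι} (hab : a ≠ b) (f : ι → M) :
    ∑ c, f c = f a + f b + ∑ c ∈ (univ.erase a).erase b, f c := by
  rw [← Finset.add_sum_erase univ f (mem_univ a), ← Finset.add_sum_erase (univ.erase a) f
    (Finset.mem_erase.2 ⟨Ne.symm hab, mem_univ b⟩), add_assoc]

/-- **The plane rotation operator implements the plane rotation**:
`P_{ab}(θ) Γ(w) = Γ(R_{ab}(θ) w) P_{ab}(θ)` (Kaufman 1949, §2; SML 1964, §III). [cite: KaufmanPhysRev1949, §2] -/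
theorem implements_planeExp (hΓ : IsMajoranaFamily Γ) {a b : ι} (hab : a ≠ b) (θ : ℝ) :
    Implements Γ (planeExp Γ a b θ) (planeRot a b θ) := by
  intro w
  have hL : planeExp Γ a b θ * fieldOp Γ w = ∑ c, w c • (planeExp Γ a b θ * Γ c) := by
    simp only [fieldOp, mul_sum, mul_smul_comm]
  have hR : fieldOp Γ (planeRot a b θ w) * planeExp Γ a b θ =
      ∑ c, planeRot a b θ w c • (Γ c * planeExp Γ a b θ) := by
    simp only [fieldOp, sum_mul, smul_mul_assoc]
  rw [hL, hR, sum_eq_add_add_sum_erase_erase hab, sum_eq_add_add_sum_erase_erase hab]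
  have hrest : ∑ c ∈ (univ.erase a).erase b, w c • (planeExp Γ a b θ * Γ c) =
      ∑ c ∈ (univ.erase a).erase b, planeRot a b θ w c • (Γ c * planeExp Γ a b θ) := by
    refine sum_congr rfl fun c hc => ?_
    have hcb : c ≠ b := (Finset.mem_erase.1 hc).1
    have hca : c ≠ a := (Finset.mem_erase.1 (Finset.mem_erase.1 hc).2).1
    rw [planeExp_mul_of_ne hΓ hca hcb, planeRot_apply_of_ne hca hcb]
  rw [hrest, planeExp_mul_left hΓ hab, planeExp_mul_right hΓ hab, planeRot_apply_left,
    planeRot_apply_right hab]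
  congr 1
  simp only [sub_mul, add_mul, smul_mul_assoc, smul_sub, smul_add, smul_smul, add_smul, neg_mul, neg_smul]
  module

end Impl

end Literature.MathematicalPhysics.FreeFermions
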